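import Summits.AtomisticToContinuum.FouriersLaw.Theses.EmbeddedDrudeMourre
import Summits.AtomisticToContinuum.FouriersLaw.Theses.KineticCorner
import Summits.AtomisticToContinuum.FouriersLaw.Theorems.EmbeddedDrudeMourreMourreDissolutionOfKineticCorner
import Summits.AtomisticToContinuum.FouriersLaw.Theorems.EmbeddedDrudeMourreDrudeDissolutionStubTargetGlue
import Summits.AtomisticToContinuum.FouriersLaw.Theorems.KineticCornerStationaryCorrelationBound
import HarnessLib

/-!
# `DrudeDissolution` (stmt-AtomisticToContinuum-12593) from the CANONICAL-DYNAMICS form of the kinetic cruxes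
# (line `Sketch`, rev 11: rigidity of the Buttà–Marchioro class factored out)

`--supports stmt-AtomisticToContinuum-12593` (lead `prover-line-stmt-AtomisticToContinuum-12593-c6-0`).

Route KineticCorner's cruxes `PostKineticTail` (stmt-3430) and `KineticLimit` (stmt-3431) — the open stubs of rev 10 of this
line — quantify over ALL "good triples" `(T, μ, D)`: every DLR state and every `μ`-preserving `InfiniteChainDynamics`
whatsoever, whose uniqueness field is only relative to its own carrier (the route's own "known formal gap": exotic good
dynamics are neither excluded nor analysable). A kinetic-limit proof can only be about the dynamics it constructs. This file
records that the crux needs the two kinetic statements ONLY in their weakest, EXISTENTIAL form over the Buttà–Marchioro class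
(`D.carrier = bmGood`, shift-invariant DLR state), once the RIGIDITY of that class is known:

* (U)    `BmRigidity` (hypothesis `hU`; provable now, registered stub `stub_bmRigidity` of the line): two pairs `(μᵢ, Dᵢ)` at
         the same `T` in the BM class have the same summed current autocorrelation `C_T` — DLR uniqueness of the
         shift-invariant state (`eq_of_isChainGibbsMeasure_of_isShiftInvariant_pinnedChain`) + uniqueness of orbits inside the
         common carrier `bmGood` (`InfiniteChainDynamics.unique`) + `bmGood` of full measure (`PreservesMeasure.1`).
* (PKT∃) `BmPostKineticTail` (hypothesis; registered stub `stub_bmPostKineticTail`, research-open): for every `e > 0` there are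
         `M, T₀ > 0` such that for every `T ∈ (0, T₀)` SOME BM-class pair has `C_T ∈ L¹(MT⁻², ∞)` with mass `≤ e` there.
* (KL∃)  `BmKineticLimit` (hypothesis; registered stub `stub_bmKineticLimit`, research-open): `∃ K ∈ L¹(0,∞)`, `∫₀^∞ K > 0`,
         such that for all `0 < δ ≤ M`, `e > 0` and `T < T₀(δ, M, e)` SOME BM-class pair has
         `|∫_{δT⁻²}^{MT⁻²} C_T − ∫_δ^M K| ≤ e`.

`drudeDissolution_of_bmRigidity_of_bmPostKineticTail_of_bmKineticLimit : (U) → (PKT∃) → (KL∃) → DrudeDissolution`: at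
`T < T₀` the canonical datum (`canonicalDatum`, p121356: carrier `bmGood`, translation covariant, zero-wavenumber datum with
DLR state and strongly continuous Koopman group) is a good triple in the BM class; by (U) the witnesses of (PKT∃)/(KL∃) have
ITS `C_T`; the landed a-priori bound `StationaryCorrelationBound` (stmt-3435, `stationaryCorrelationBound_proof`) and the landed
dominated tiling `targetGlue_tiling` (p122724) give `C_T ∈ L¹(0,∞)` with `∫₀^∞ C_T ≥ c/2 > 0`, and the landed cosine-Bochner
theorem (`stub_cosineBochner`) with the integrable-spectral criterion (`stub_integrableSpectralCriterion`, S1) give the window.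
`bmPostKineticTail_of_postKineticTail`, `bmKineticLimit_of_kineticLimit`: the route's cruxes still imply the existential forms
(witness = the canonical datum), so closing stmt-3430 ∧ stmt-3431 still closes the crux. CONDITIONAL results (hypotheses open).
-/

noncomputable section

open MeasureTheory Filter Set Function
open scoped Topology

namespace Summit.AtomisticToContinuum.FouriersLaw.Theorems.DrudeDissolution.LineSketch

open Literature.MathematicalPhysics.KineticTheory.HeatConduction

/-- **`PostKineticTail ⇒` its existential BM-class form (PKT∃)**: the witness at each `T` is the canonical datum of
`canonicalDatum` (a good triple with carrier `bmGood`, `goodTriple_of_canonicalDatum`). [folklore] -/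
theorem bmPostKineticTail_of_postKineticTail :
    Summit.AtomisticToContinuum.FouriersLaw.Theses.KineticCorner.PostKineticTail →
    (∀ ω₂ lam β γ : ℝ, 0 < ω₂ → 0 < lam → 0 < β → 0 < γ → ∀ e : ℝ, 0 < e →
      ∃ M T₀ : ℝ, 0 < M ∧ 0 < T₀ ∧ ∀ T : ℝ, 0 < T → T < T₀ →
        ∃ (μ : MeasureTheory.Measure Literature.MathematicalPhysics.KineticTheory.HeatConduction.ChainConfig)
          (D : Literature.MathematicalPhysics.KineticTheory.HeatConduction.InfiniteChainDynamics
            (Literature.MathematicalPhysics.KineticTheory.HeatConduction.pinnedChain ω₂ lam β γ)),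
          (Literature.MathematicalPhysics.KineticTheory.HeatConduction.pinnedChain ω₂ lam β γ).IsChainGibbsMeasure T μ ∧
          MeasureTheory.MeasurePreserving
            (fun σ : Literature.MathematicalPhysics.KineticTheory.HeatConduction.ChainConfig => fun i : ℤ => σ (i + 1)) μ μ ∧
          D.carrier = (Literature.MathematicalPhysics.KineticTheory.HeatConduction.pinnedChain ω₂ lam β γ).bmGood ∧
          D.PreservesMeasure μ ∧
          MeasureTheory.IntegrableOn (D.currentCorrelation μ) (Set.Ioi (M / T ^ 2)) ∧
          ∫ t in Set.Ioi (M / T ^ 2), |D.currentCorrelation μ t| ≤ e) := by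
  intro hPKT ω₂ lam β γ hω hl hβ hγ e he
  obtain ⟨M, T₀, hM, hT₀, h⟩ := hPKT ω₂ lam β γ hω hl hβ hγ e he
  refine ⟨M, T₀, hM, hT₀, fun T hT hTlt => ?_⟩
  obtain ⟨D, hD, hsh, hZ⟩ := MourreDissolution.canonicalDatum ω₂ lam β γ hω hl hβ
  obtain ⟨Z, hG, -, -, hsc⟩ := hZ T hT
  have hgood := MourreDissolution.goodTriple_of_canonicalDatum hsh Z hG hsc
  obtain ⟨hInt, htail⟩ := h T Z.μ D hT hTlt hgood
  exact ⟨Z.μ, D, hG, hgood.2.2.2.2.1, hD, hgood.2.1, hInt, htail⟩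

/-- **`KineticLimit ⇒` its existential BM-class form (KL∃)**: same kinetic profile `K`; the witness at each `T` is
the canonical datum of `canonicalDatum`. [folklore] -/
theorem bmKineticLimit_of_kineticLimit :
    Summit.AtomisticToContinuum.FouriersLaw.Theses.KineticCorner.KineticLimit →
    (∀ ω₂ lam β γ : ℝ, 0 < ω₂ → 0 < lam → 0 < β → 0 < γ →
      ∃ K : ℝ → ℝ, MeasureTheory.IntegrableOn K (Set.Ioi 0) ∧ 0 < ∫ τ in Set.Ioi 0, K τ ∧
        ∀ δ M e : ℝ, 0 < δ → δ ≤ M → 0 < e → ∃ T₀ : ℝ, 0 < T₀ ∧ ∀ T : ℝ, 0 < T → T < T₀ →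
          ∃ (μ : MeasureTheory.Measure Literature.MathematicalPhysics.KineticTheory.HeatConduction.ChainConfig)
            (D : Literature.MathematicalPhysics.KineticTheory.HeatConduction.InfiniteChainDynamics
              (Literature.MathematicalPhysics.KineticTheory.HeatConduction.pinnedChain ω₂ lam β γ)),
            (Literature.MathematicalPhysics.KineticTheory.HeatConduction.pinnedChain ω₂ lam β γ).IsChainGibbsMeasure T μ ∧
            MeasureTheory.MeasurePreserving
              (fun σ : Literature.MathematicalPhysics.KineticTheory.HeatConduction.ChainConfig => fun i : ℤ => σ (i + 1)) μ μ ∧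
            D.carrier = (Literature.MathematicalPhysics.KineticTheory.HeatConduction.pinnedChain ω₂ lam β γ).bmGood ∧
            D.PreservesMeasure μ ∧
            |(∫ t in (δ / T ^ 2)..(M / T ^ 2), D.currentCorrelation μ t) - ∫ τ in δ..M, K τ| ≤ e) := by
  intro hKL ω₂ lam β γ hω hl hβ hγ
  obtain ⟨K, hK, hc, h⟩ := hKL ω₂ lam β γ hω hl hβ hγ
  refine ⟨K, hK, hc, fun δ M e hδ hδM he => ?_⟩
  obtain ⟨T₀, hT₀, hw⟩ := h δ M e hδ hδM he
  refine ⟨T₀, hT₀, fun T hT hTlt => ?_⟩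
  obtain ⟨D, hD, hsh, hZ⟩ := MourreDissolution.canonicalDatum ω₂ lam β γ hω hl hβ
  obtain ⟨Z, hG, -, -, hsc⟩ := hZ T hT
  have hgood := MourreDissolution.goodTriple_of_canonicalDatum hsh Z hG hsc
  exact ⟨Z.μ, D, hG, hgood.2.2.2.2.1, hD, hgood.2.1, hw T Z.μ D hT hTlt hgood⟩

/-- **`DrudeDissolution ⇐ BmRigidity ∧ BmPostKineticTail ∧ BmKineticLimit`** (the crux stmt-AtomisticToContinuum-12593
from the rigidity of the Buttà–Marchioro class (U) and the EXISTENTIAL, canonical-dynamics forms (PKT∃), (KL∃) of route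
KineticCorner's two cruxes; line `Sketch`, rev 11; registered deliverable). Proof: `c := ∫₀^∞ K > 0`; choose the
initial-layer width `δ` (`B⁺δ ≤ c/8`, `∫_{(0,δ]}|K| ≤ c/16`), the tail datum `(M₀, T₀′)` of (PKT∃) at `c/8`, the kinetic
multiple `M ≥ max M₀ δ` with `∫_{(M,∞)}|K| ≤ c/16`, and `T₀″` of (KL∃) at `(δ, M, c/8)`; for `T < min T₀′ T₀″ T₁`: the
canonical datum `(Z.μ, D)` is a good triple with carrier `bmGood`, the witnesses of (PKT∃) and (KL∃) at `T` have the same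
`C_T` by (U), the a-priori bound `|C_T| ≤ B T²` (`stationaryCorrelationBound_proof`) and the dominated tiling
`targetGlue_tiling` give `C_T ∈ L¹(0,∞)` and `|∫₀^∞ C_T − c| ≤ c/2`; `C_T` is continuous, even, of positive type
(`regular_of_zeroWavenumberData`), so Bochner (`stub_cosineBochner`) and the integrable-spectral criterion
(`stub_integrableSpectralCriterion`) give the window density, positive at `0`. CONDITIONAL ((PKT∃), (KL∃) research-open;
(U) provable now). [folklore] -/
theorem drudeDissolution_of_bmRigidity_of_bmPostKineticTail_of_bmKineticLimit :
    (∀ ω₂ lam β γ : ℝ, 0 < ω₂ → 0 < lam → 0 < β → 0 < γ →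
      ∀ (T : ℝ) (μ₁ μ₂ : MeasureTheory.Measure Literature.MathematicalPhysics.KineticTheory.HeatConduction.ChainConfig)
        (D₁ D₂ : Literature.MathematicalPhysics.KineticTheory.HeatConduction.InfiniteChainDynamics
          (Literature.MathematicalPhysics.KineticTheory.HeatConduction.pinnedChain ω₂ lam β γ)),
        0 < T →
        (Literature.MathematicalPhysics.KineticTheory.HeatConduction.pinnedChain ω₂ lam β γ).IsChainGibbsMeasure T μ₁ →
        (Literature.MathematicalPhysics.KineticTheory.HeatConduction.pinnedChain ω₂ lam β γ).IsChainGibbsMeasure T μ₂ →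
        MeasureTheory.MeasurePreserving
          (fun σ : Literature.MathematicalPhysics.KineticTheory.HeatConduction.ChainConfig => fun i : ℤ => σ (i + 1)) μ₁ μ₁ →
        MeasureTheory.MeasurePreserving
          (fun σ : Literature.MathematicalPhysics.KineticTheory.HeatConduction.ChainConfig => fun i : ℤ => σ (i + 1)) μ₂ μ₂ →
        D₁.carrier = (Literature.MathematicalPhysics.KineticTheory.HeatConduction.pinnedChain ω₂ lam β γ).bmGood →
        D₂.carrier = (Literature.MathematicalPhysics.KineticTheory.HeatConduction.pinnedChain ω₂ lam β γ).bmGood →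
        D₁.PreservesMeasure μ₁ →
        μ₁ = μ₂ ∧
          (∀ (t : ℝ) (σ : Literature.MathematicalPhysics.KineticTheory.HeatConduction.ChainConfig),
            σ ∈ (Literature.MathematicalPhysics.KineticTheory.HeatConduction.pinnedChain ω₂ lam β γ).bmGood →
              D₁.flow t σ = D₂.flow t σ) ∧
          ∀ t : ℝ, D₁.currentCorrelation μ₁ t = D₂.currentCorrelation μ₂ t) →
    (∀ ω₂ lam β γ : ℝ, 0 < ω₂ → 0 < lam → 0 < β → 0 < γ → ∀ e : ℝ, 0 < e →
      ∃ M T₀ : ℝ, 0 < M ∧ 0 < T₀ ∧ ∀ T : ℝ, 0 < T → T < T₀ →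
        ∃ (μ : MeasureTheory.Measure Literature.MathematicalPhysics.KineticTheory.HeatConduction.ChainConfig)
          (D : Literature.MathematicalPhysics.KineticTheory.HeatConduction.InfiniteChainDynamics
            (Literature.MathematicalPhysics.KineticTheory.HeatConduction.pinnedChain ω₂ lam β γ)),
          (Literature.MathematicalPhysics.KineticTheory.HeatConduction.pinnedChain ω₂ lam β γ).IsChainGibbsMeasure T μ ∧
          MeasureTheory.MeasurePreserving
            (fun σ : Literature.MathematicalPhysics.KineticTheory.HeatConduction.ChainConfig => fun i : ℤ => σ (i + 1)) μ μ ∧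
          D.carrier = (Literature.MathematicalPhysics.KineticTheory.HeatConduction.pinnedChain ω₂ lam β γ).bmGood ∧
          D.PreservesMeasure μ ∧
          MeasureTheory.IntegrableOn (D.currentCorrelation μ) (Set.Ioi (M / T ^ 2)) ∧
          ∫ t in Set.Ioi (M / T ^ 2), |D.currentCorrelation μ t| ≤ e) →
    (∀ ω₂ lam β γ : ℝ, 0 < ω₂ → 0 < lam → 0 < β → 0 < γ →
      ∃ K : ℝ → ℝ, MeasureTheory.IntegrableOn K (Set.Ioi 0) ∧ 0 < ∫ τ in Set.Ioi 0, K τ ∧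
        ∀ δ M e : ℝ, 0 < δ → δ ≤ M → 0 < e → ∃ T₀ : ℝ, 0 < T₀ ∧ ∀ T : ℝ, 0 < T → T < T₀ →
          ∃ (μ : MeasureTheory.Measure Literature.MathematicalPhysics.KineticTheory.HeatConduction.ChainConfig)
            (D : Literature.MathematicalPhysics.KineticTheory.HeatConduction.InfiniteChainDynamics
              (Literature.MathematicalPhysics.KineticTheory.HeatConduction.pinnedChain ω₂ lam β γ)),
            (Literature.MathematicalPhysics.KineticTheory.HeatConduction.pinnedChain ω₂ lam β γ).IsChainGibbsMeasure T μ ∧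
            MeasureTheory.MeasurePreserving
              (fun σ : Literature.MathematicalPhysics.KineticTheory.HeatConduction.ChainConfig => fun i : ℤ => σ (i + 1)) μ μ ∧
            D.carrier = (Literature.MathematicalPhysics.KineticTheory.HeatConduction.pinnedChain ω₂ lam β γ).bmGood ∧
            D.PreservesMeasure μ ∧
            |(∫ t in (δ / T ^ 2)..(M / T ^ 2), D.currentCorrelation μ t) - ∫ τ in δ..M, K τ| ≤ e) →
    Summit.AtomisticToContinuum.FouriersLaw.Theses.EmbeddedDrudeMourre.DrudeDissolution := by
  intro hU hPKT hKL ω₂ lam β γ hω hl hβ hγ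
  obtain ⟨K, hKint, hc, hwin⟩ := hKL ω₂ lam β γ hω hl hβ hγ
  obtain ⟨B, T₁b, hT₁b, hSCB⟩ := KineticCorner.stationaryCorrelationBound_proof ω₂ lam β γ hω hl hβ hγ
  set c : ℝ := ∫ τ in Ioi 0, K τ with hc_def
  -- constants: `B⁺ ≥ max B 1`, initial-layer width `δ`, tail datum `(M₀, T₀')`, kinetic multiple `M`, window datum `T₀''`
  obtain ⟨Bp, hBp, hBBp⟩ : ∃ Bp : ℝ, 0 < Bp ∧ B ≤ Bp := ⟨max B 1, lt_max_of_lt_right one_pos, le_max_left _ _⟩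
  obtain ⟨δ₀, hδ₀, hhead⟩ := targetGlue_exists_head_le hKint (ε := c / 16) (by positivity)
  obtain ⟨δ, hδpos, hδδ₀, hδB⟩ : ∃ δ : ℝ, 0 < δ ∧ δ ≤ δ₀ ∧ δ ≤ c / (8 * Bp) :=
    ⟨min δ₀ (c / (8 * Bp)), lt_min hδ₀ (by positivity), min_le_left _ _, min_le_right _ _⟩
  have hBδ : Bp * δ ≤ c / 2 / 4 := by
    have h := (le_div_iff₀ (by positivity : (0 : ℝ) < 8 * Bp)).1 hδB
    linarith
  have hheadδ : ∫ x in Ioc 0 δ, |K x| ≤ c / 16 := hhead δ hδδ₀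
  obtain ⟨M₀, T₀', _, hT₀', hPKT'⟩ := hPKT ω₂ lam β γ hω hl hβ hγ (c / 2 / 4) (by positivity)
  obtain ⟨M, hMge, htailK⟩ := targetGlue_exists_tail_le hKint (ε := c / 16) (by positivity) (max M₀ δ)
  have hM₀M : M₀ ≤ M := (le_max_left _ _).trans hMge
  have hδM : δ ≤ M := (le_max_right _ _).trans hMge
  obtain ⟨T₀'', hT₀'', hwin'⟩ := hwin δ M (c / 2 / 4) hδpos hδM (by positivity)
  have hKwin : |(∫ τ in δ..M, K τ) - c| ≤ c / 2 / 4 := by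
    have h := targetGlue_window_close hKint hδpos hδM hheadδ htailK
    rw [← hc_def] at h
    linarith
  refine ⟨min (min T₀' T₀'') T₁b, lt_min (lt_min hT₀' hT₀'') hT₁b, fun T hT hTlt => ?_⟩
  have hT1 : T < T₀' := hTlt.trans_le ((min_le_left _ _).trans (min_le_left _ _))
  have hT2 : T < T₀'' := hTlt.trans_le ((min_le_left _ _).trans (min_le_right _ _))
  have hT3 : T < T₁b := hTlt.trans_le (min_le_right _ _)
  have hT2pos : 0 < T ^ 2 := by positivity
  -- the canonical datum at `T`: a good triple in the BM class
  obtain ⟨D, hD, hsh, hZ⟩ := MourreDissolution.canonicalDatum ω₂ lam β γ hω hl hβ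
  obtain ⟨Z, hG, -, -, hsc⟩ := hZ T hT
  have hgood := MourreDissolution.goodTriple_of_canonicalDatum hsh Z hG hsc
  obtain ⟨hP, hA, hcont, heven, hpsd⟩ := regular_of_zeroWavenumberData Z hG hsc
  -- transfer the tail and window properties of the witnesses to the canonical `C_T` by rigidity
  obtain ⟨μ₁, D₁, hG₁, hshift₁, hD₁, hP₁, htailInt₁, htail₁⟩ := hPKT' T hT hT1
  obtain ⟨μ₂, D₂, hG₂, hshift₂, hD₂, hP₂, hwin₂⟩ := hwin' T hT hT2
  have hC₁ : D₁.currentCorrelation μ₁ = D.currentCorrelation Z.μ :=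
    funext (hU ω₂ lam β γ hω hl hβ hγ T μ₁ Z.μ D₁ D hT hG₁ hG hshift₁ hgood.2.2.2.2.1 hD₁ hD hP₁).2.2
  have hC₂ : D₂.currentCorrelation μ₂ = D.currentCorrelation Z.μ :=
    funext (hU ω₂ lam β γ hω hl hβ hγ T μ₂ Z.μ D₂ D hT hG₂ hG hshift₂ hgood.2.2.2.2.1 hD₂ hD hP₂).2.2
  rw [hC₁] at htailInt₁ htail₁
  rw [hC₂] at hwin₂
  -- dominated tiling
  have hbd : ∀ t : ℝ, 0 ≤ t → |D.currentCorrelation Z.μ t| ≤ Bp * T ^ 2 := fun t ht =>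
    (hSCB T Z.μ D hT hT3 hgood t ht).trans (mul_le_mul_of_nonneg_right hBBp hT2pos.le)
  obtain ⟨hInt, hclose⟩ := targetGlue_tiling (K := K) (c := c) hT hδpos hM₀M hδM hgood.2.2.2.1 htailInt₁ htail₁
    hbd hBδ hwin₂ hKwin
  have hpos : 0 < ∫ t in Ioi (0 : ℝ), D.currentCorrelation Z.μ t := by
    have h := (abs_le.1 hclose).1
    linarith
  -- Bochner + the integrable-spectral criterion
  obtain ⟨σ, hσ, hC⟩ := MourreDissolution.stub_cosineBochner _ hcont heven hpsd
  obtain ⟨σ', hσ', hC', δ', g, hδ', hg, hg0, hgpos, hres⟩ :=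
    stub_integrableSpectralCriterion σ _ hσ hC hInt hpos
  exact ⟨Z.μ, D, hG, hP, hA, σ', hσ', hC', δ', g, hδ', hg, hg0, hgpos, hres⟩

/-- **`DrudeDissolution ⇐ BmRigidity ∧ PostKineticTail ∧ KineticLimit`** (registered deliverable): rev 10's closure
path survives rev 11 — route KineticCorner's cruxes stmt-3430 ∧ stmt-3431 (∀ good triples) imply their existential BM-class
forms, hence, with the rigidity (U), the crux. CONDITIONAL (stmt-3430, stmt-3431 open; (U) provable now). [folklore] -/
theorem drudeDissolution_of_bmRigidity_of_postKineticTail_of_kineticLimit :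
    (∀ ω₂ lam β γ : ℝ, 0 < ω₂ → 0 < lam → 0 < β → 0 < γ →
      ∀ (T : ℝ) (μ₁ μ₂ : MeasureTheory.Measure Literature.MathematicalPhysics.KineticTheory.HeatConduction.ChainConfig)
        (D₁ D₂ : Literature.MathematicalPhysics.KineticTheory.HeatConduction.InfiniteChainDynamics
          (Literature.MathematicalPhysics.KineticTheory.HeatConduction.pinnedChain ω₂ lam β γ)),
        0 < T →
        (Literature.MathematicalPhysics.KineticTheory.HeatConduction.pinnedChain ω₂ lam β γ).IsChainGibbsMeasure T μ₁ →
        (Literature.MathematicalPhysics.KineticTheory.HeatConduction.pinnedChain ω₂ lam β γ).IsChainGibbsMeasure T μ₂ →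
        MeasureTheory.MeasurePreserving
          (fun σ : Literature.MathematicalPhysics.KineticTheory.HeatConduction.ChainConfig => fun i : ℤ => σ (i + 1)) μ₁ μ₁ →
        MeasureTheory.MeasurePreserving
          (fun σ : Literature.MathematicalPhysics.KineticTheory.HeatConduction.ChainConfig => fun i : ℤ => σ (i + 1)) μ₂ μ₂ →
        D₁.carrier = (Literature.MathematicalPhysics.KineticTheory.HeatConduction.pinnedChain ω₂ lam β γ).bmGood →
        D₂.carrier = (Literature.MathematicalPhysics.KineticTheory.HeatConduction.pinnedChain ω₂ lam β γ).bmGood →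
        D₁.PreservesMeasure μ₁ →
        μ₁ = μ₂ ∧
          (∀ (t : ℝ) (σ : Literature.MathematicalPhysics.KineticTheory.HeatConduction.ChainConfig),
            σ ∈ (Literature.MathematicalPhysics.KineticTheory.HeatConduction.pinnedChain ω₂ lam β γ).bmGood →
              D₁.flow t σ = D₂.flow t σ) ∧
          ∀ t : ℝ, D₁.currentCorrelation μ₁ t = D₂.currentCorrelation μ₂ t) →
    Summit.AtomisticToContinuum.FouriersLaw.Theses.KineticCorner.PostKineticTail →
    Summit.AtomisticToContinuum.FouriersLaw.Theses.KineticCorner.KineticLimit →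
    Summit.AtomisticToContinuum.FouriersLaw.Theses.EmbeddedDrudeMourre.DrudeDissolution :=
  fun hU hPKT hKL => drudeDissolution_of_bmRigidity_of_bmPostKineticTail_of_bmKineticLimit hU
    (bmPostKineticTail_of_postKineticTail hPKT) (bmKineticLimit_of_kineticLimit hKL)

end Summit.AtomisticToContinuum.FouriersLaw.Theorems.DrudeDissolution.LineSketch

end
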